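import Literature.MathematicalPhysics.QuantumFieldTheory.Balaban1983to89.B8LeafModelZd

/-!
# `Balaban1983to89.B8LeafModelZdSockP5uE` — [Balaban1985RegularSpaces] PROPOSITION 5 (p. 94), UNIQUENESS CLAUSE (1.109): THE REPAIRED
# SOCKET `SockP5uE` OF THE N05 KNIT (the Theorem-4 family `B8LeafModelZd.zdGF` / `B8LeafModelZd3.zdGF3`)

statement-level skeleton of published theorems with citation tags; nothing here is a claim about the Yang–Mills mass gap

PDF held: `paper:balaban1985-cmp99-regular-spaces-gauge-fixing` (journal page = PDF page + 74); p. 94 (Proposition 5, (1.107)–(1.109)),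
p. 89 (the datum of Theorem 4's induction), p. 90 ((1.77), the norm `|·|₍₋₁₎`), p. 95 (the uniqueness paragraph).

WHY THIS FILE (cell `pub-ymgap`, seat `pub-ymgap-dag-n05-a` g7 = the OWNER of the sockets of `B8LeafModelZd`).  The uniqueness socket
`B8LeafModelZd.SockP5u` (g4) quantifies over EVERY unitary restricted datum `u₁` and reads the competitors' gauge parameters `λ`, `μ` on
the towers `Bʲ(y)`, `y ∈ Λ_j` only.  The provider seat `pub-ymgap-dag-n04-b` (g5; `B8Prop5UniqKLevel.hFP_unique_kLevel` = the
JOIN-side converse of Proposition 5 at k levels) LOCATED that this text is not inhabitable by a proof of print's Proposition 5: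
(a) DATUM — print's (1.109) is for the datum `(u₁, U₁ = U′^{u₁⁻¹})` WITH (1.69) for `U₁` and (1.68)/(1.73)/(1.74) for `u₁` («for the
configuration u₁ determined by U₁ and satisfying (1.68), (1.73), (1.74)», p. 94), i.e. `u₁` carried by `Ω₀`, `U′^{u₁⁻¹}` in the Landau
gauge (1.38) with the (1.36)/(1.62)-shape `U′^{u₁⁻¹} = e^{iηA₁}`, `|A₁| ≤ 5dLB₀(α₀ + α₁)(Lʲη)⁻¹` on the bonds touching `Ω_j` — exactly
the binders `hu'S`, `hLan'`, `h162'` in scope at the consumer `B8Thm4Concrete.thm4Body_concrete_guarded` (the socket gains the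
parameter `B₀`, FREE: the same symbol as the (1.59) socket's `B₀`); (b) CARRIER — competitors `v`, `w` carried by `Ω₀` (`λ = μ = 0` off
`Ω₀`), read through `λ`, `μ` at every site; (c) CURRENCY — the domain (1.109) «|λ|, |Dλ|₍₋₁₎ < c₃» with `|·|₍₋₁₎` ((1.77) p. 90) the
weighted supremum over ALL bonds touching `Ω_j`: `(Lʲη)|(D_{U₀}λ)(b)| < c_u` for `b ∈ SideTouches (Ω j)`, `j ≤ k` (the (1.108)
currency of the existence sockets `SockP5` / `SockHFP`).  The text below is n04-b's proposed DECL verbatim (scratch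
`SockP5uE_decl.scratch.lean`, 2026-08-26), adopted by the socket owner; the consumer in this currency is
`B8Thm4UniqueE.thm4_unique_eq_landau138E`; the provider targets this name.

HONEST SCOPE.  One definition (a `Prop`-valued socket = a HYPOTHESIS SHAPE of the knit); nothing of Proposition 5 is asserted or proved
here.  Count-neutral; N05 NOT discharged; nothing continuum / ℝ⁴ / OS / mass-gap / Clay.  Unit `pub-ymgap-dag-n05-a` (g7), 2026-08-26.
-/

noncomputable section

namespace Literature.MathematicalPhysics.QuantumFieldTheory.Balaban1983to89.B8LeafModelZdSockP5uE

open B7Prop1Explicit B7Prop2Explicit B7Prop1Local B7Eq92Concrete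
open B8Ineq132 (covDerivFwd InAk)
open B8Eq119TwistedAxial (Restr129 InAx)
open B8Eq184Proof (gaugeExp cfgExp)
open B8Lemma1NonAbelian (mulCfg)
open B8Eq140Level (SideTouches)
open B8Eq138LandauZd (IsLandau138W)

variable {d : ℕ} {𝔸 : Type*} [CStarAlgebra 𝔸] [Nontrivial 𝔸]

/-- **The Proposition-5 UNIQUENESS socket, repaired** ((1.109) p. 94 for the PRINTED datum: `U₁ = U′^{u₁⁻¹}` in the Landau gauge (1.38)
of record with the (1.36)/(1.62)-shape at `c⋆ = 5dLB₀(α₀ + α₁)`, `u₁` carried by `Ω₀` with (1.29); competitors `v = e^{iλ}`, `w = e^{iμ}`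
carried by `Ω₀` with `λ`, `μ` in print's domain «|λ|, |Dλ|₍₋₁₎ < c_u» read at every site and on EVERY bond touching `Ω_j` (the (1.108)
currency of `SockP5` / `SockHFP`), both solving (1.107) for the datum; conclusion `v = w`), guarded by the providers' threshold `cP` and
the datum's (1.33)/(1.34)/(1.34)-axial/(1.35)/(1.66)₀ hypotheses (the guard of every socket of `B8LeafModelZd`).
[cite: Balaban1985RegularSpaces, Prop. 5 (1.109) p.94, (1.107)–(1.108) p.94, (1.77) p.90, (1.36)–(1.38) p.82, (1.62) p.87, (1.29) p.81] -/
def SockP5uE (L : ℕ) (B₀ cP cu : ℝ) (η : ℝ) (k : ℕ) (Ω : ℕ → Set (B7Prop1Explicit.Site d)) (Λs : ℕ → ℕ → Set (B7Prop1Explicit.Site d)) : Prop :=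
  ∀ α₀ α₁ : ℝ, 0 < α₀ → 0 < α₁ → α₀ + α₁ ≤ cP →
      ∀ U₀ U' : B7Prop1Explicit.Site d → Fin d → 𝔸ˣ, (∀ x κ, U₀ x κ ∈ unitaryUnits 𝔸) → (∀ x κ, U' x κ ∈ unitaryUnits 𝔸) →
      InAk L k η α₀ Ω U₀ → InAk L k η α₀ Ω (mulCfg U' U₀) → (∀ m, m ≤ k → InAx L m (Λs m) U₀ (mulCfg U' U₀)) →
      (∀ j, j ≤ k → ∀ (z : B7Prop1Explicit.Site d) (μ : Fin d), (∀ x, InBox (loK L j z) (bondHiK L j z μ) x → x ∈ Ω j) →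
        ‖(avgIter L (mulCfg U' U₀) j z μ : 𝔸) - (avgIter L U₀ j z μ : 𝔸)‖ ≤ α₁) →
      (∀ b ∈ {b : B7Prop1Explicit.Site d × Fin d | SideTouches (Ω 0) b.1 b.2}, ‖((U' b.1 b.2 : 𝔸ˣ) : 𝔸) - 1‖ ≤ α₁) →
      ∀ u₁ : B7Prop1Explicit.Site d → 𝔸ˣ, (∀ x, u₁ x ∈ unitaryUnits 𝔸) → (∀ x, x ∉ Ω 0 → u₁ x = 1) → Restr129 L k (Λs k) U₀ u₁ →
      IsLandau138W L k η (Ω 0) (Λs k) U₀ (mgauge U₀ u₁⁻¹ U') →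
      (∃ A₁ : B7Prop1Explicit.Site d → Fin d → 𝔸, ∀ j, j ≤ k → ∀ (x : B7Prop1Explicit.Site d) (κ : Fin d), SideTouches (Ω j) x κ →
        mgauge U₀ u₁⁻¹ U' x κ = cfgExp η A₁ x κ ∧ ‖A₁ x κ‖ ≤ (5 * (d : ℝ) * L * B₀ * (α₀ + α₁)) * ((L : ℝ) ^ j * η)⁻¹) →
      ∀ (v w : B7Prop1Explicit.Site d → 𝔸ˣ) (lam mu : B7Prop1Explicit.Site d → 𝔸),
      (∀ x, ((gaugeExp lam x : 𝔸ˣ) : 𝔸) = ((v x : 𝔸ˣ) : 𝔸) ∧ IsSelfAdjoint (lam x) ∧ ‖lam x‖ < cu) → (∀ x, x ∉ Ω 0 → lam x = 0) →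
      (∀ j, j ≤ k → ∀ b ∈ {b : B7Prop1Explicit.Site d × Fin d | SideTouches (Ω j) b.1 b.2}, ((L : ℝ) ^ j * η) * ‖covDerivFwd η U₀ b.2 lam b.1‖ < cu) →
      (∀ x, ((gaugeExp mu x : 𝔸ˣ) : 𝔸) = ((w x : 𝔸ˣ) : 𝔸) ∧ IsSelfAdjoint (mu x) ∧ ‖mu x‖ < cu) → (∀ x, x ∉ Ω 0 → mu x = 0) →
      (∀ j, j ≤ k → ∀ b ∈ {b : B7Prop1Explicit.Site d × Fin d | SideTouches (Ω j) b.1 b.2}, ((L : ℝ) ^ j * η) * ‖covDerivFwd η U₀ b.2 mu b.1‖ < cu) →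
      IsLandau138W L k η (Ω 0) (Λs k) U₀ (mgauge U₀ v⁻¹ (mgauge U₀ u₁⁻¹ U')) → Restr129 L k (Λs k) U₀ (u₁ * v) →
      IsLandau138W L k η (Ω 0) (Λs k) U₀ (mgauge U₀ w⁻¹ (mgauge U₀ u₁⁻¹ U')) → Restr129 L k (Λs k) U₀ (u₁ * w) →
      ∀ x, v x = w x

end Literature.MathematicalPhysics.QuantumFieldTheory.Balaban1983to89.B8LeafModelZdSockP5uE

end
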